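import Summits.QuantumFields.BalabanUV.T4Continuum.Support.WilsonLineTower

/-!
# T⁴ programme, spine node NE2 (U1a), lane P2 — «WILSON-LINE TOWERS», file 2: THE OPERATOR WILSON-LINE TOWER OF A LIPSCHITZ CONTINUUM CONNECTION
# INHABITS EVERY DATA HYPOTHESIS OF THE VECTOR END AT BAŁABAN's TAXI DATA — unitary, plaquette class `(L^{k+1})²·b_k ≤ 2·lip`, COHERENT
# EXACTLY, regular presentation `L^k·ar_k ≤ α₀`, `(L^k)²·ℓr_k ≤ lip` (model level; cell `pub-balaban`)

NE2 formalisation swarm `b2b-balaban-t4-ne2-formalise-*`, leaf prover 04 GEN 8 (`prover-b2b-balaban-t4-ne2-formalise-leaf-04-g8-0`); register row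
«P2-sup» of `t4/formal/NE2/LEAVES.md`; journal CLAIMS.log INTENT «WILSON-LINE TOWERS» 2026-08-20 l.23684.  On top of file 1 (`WilsonLineTower`: the
Wilson-line phases `wl`, bond variables `wlR`, their size ∕ Lipschitz ∕ commutator bounds and the exact coherence `coarseT_wlR` ∕ `Rtr_wlR`), leaf-02-g4's
`VariationalColourFederbush.{phase, piTv_phase}` and this lineage's tower dictionary `VariationalColourTaxiTransport.{coarseTv, Rlev}` ∕ leaf-02-g4's
`VariationalColourTower.Rtrv` BY NAME.

THE OBJECT ([folklore], OURS).  **`wlTower L M A k : Tor (fine L (fine (L^k) M)) → Fin d → (ℂ →L[ℂ] ℂ) := fun x => phase (wlR (L^k·L) A x)`** — the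
one-step bond operators of level `k+1` (spacing `(L^k·L)⁻¹` on the torus `Π_ν ℝ∕M_ν`), presented over the level-`k` torus exactly as the vector END's
data `R′ k`: multiplication by the Wilson line `exp(i∫_bond A)` of the continuum connection `A`.
THE THEOREMS — one per data binder of `VariationalColourTaxiTowerCentredEndRegular.effV_tendsto_taxiTower_projG_centred_regular` (p241220) ∕ leaf-10's
rate host, for `A` bounded (`|A p μ| ≤ α₀`), Lipschitz along the coordinate directions (`|A (p + h·e_ν) μ − A p μ| ≤ lip·|h|`), `M`-periodic and
continuous:
 * §1 `phase_mem_unitary`, `phase_mul_phase`, `norm_phase_sub_phase` (the `E = ℂ` dictionary: unit phases are unitary multiplication operators);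
 * §2 `hU`: **`wlTower_mem_unitary`**; `hb` ∕ `hb0` ∕ `hbc`: **`wlTower_comm_le`** —
   `‖R′ k x κ·R′ k (x+e_κ) ι − R′ k x ι·R′ k (x+e_ι) κ‖ ≤ wlB L lip k := 2·lip∕(L^{k+1})²`, `0 ≤ wlB`, `(L^{k+1})²·wlB L lip k = 2·lip` (`wlB_class`);
 * §3 `hcoh`: **`wlTower_coherent`** — `coarseTv L (fine (L^{k+1}) M) (wlTower (k+1)) = Rtrv (L^k) L M (wlTower k)` EXACTLY (file 1's `coarseT_wlR` read
   through `piTv_phase`; `Rtr_wlR`);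
 * §4 THE REGULAR PRESENTATION: `Rlev_wlTower` (the level-`k` bond operators of the tower ARE the Wilson lines at spacing `(L^k)⁻¹`), `har` ∕ `hα`:
   **`norm_Rlev_wlTower_sub_one_le`** — `‖Rlev k x μ − 1‖ ≤ wlAr L α₀ k := α₀∕L^k`, `L^k·wlAr L α₀ k = α₀` (`wlAr_class`); `hℓr` ∕ `hlam`:
   **`norm_Rlev_wlTower_sub_back_le`** — `‖Rlev k x μ − Rlev k (x − e_μ) μ‖ ≤ wlLr L lip k := lip∕(L^k)²`, `(L^k)²·wlLr L lip k = lip` (`wlLr_class`).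
So at these data the END's class constant is `c = 2·lip`, its presentation constants `α = α₀`, `λ = lip`: ALL FOUR scale with the amplitude of `A`,
and only the END's numeric smallness lines remain (files 4–6).  Non-flat members: any `A` with a non-closed component, e.g. file 3's
`cosA = ε·cos(2πp_{μ₀}∕M_{μ₀})·dx_{μ₁}`.

HONEST FRAMING (T4-DAG p. 1).  [folklore] bookkeeping on OUR model objects (U(1), `E = ℂ`; c5: nothing here is Bałaban's `U_k`, no B0); nothing
printed is a hypothesis; data `def`s `wlTower` and the three constant sequences `wlB`∕`wlAr`∕`wlLr` only, no `def … : Prop`, no `sorry`; axioms standard.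
This file proves NO END (files 4–6 instantiate the scalar and vector ENDs); V-END with background ∕ NE2 NOT proved; NE3 OPEN; spine PROVED 0∕9 unchanged; rung (B)+1 on a fixed
finite T⁴ — NOT infinite volume, NOT mass gap, NOT Clay.  HONEST DEPENDENCY (cell, verbatim): continuum YM on T⁴ ⇐ BetaPertH ∧ nine spine estimates
(0/9 proved); BetaPertH ⇐ (D1) ∧ (D4) ∧ CAP+tail; G-an2-4 gates asym, D1 and NE2/3/4.
-/

noncomputable section

open scoped BigOperators ComplexConjugate

namespace Summit.QuantumFields.BalabanUV.T4Continuum.WilsonLineTower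

open Literature.MathematicalPhysics.QuantumFieldTheory.Balaban1983to89.B5Prop11Plancherel (Tor fine unitVec)
open Literature.MathematicalPhysics.QuantumFieldTheory.Balaban1983to89.B5Block118 (bpt)
open Literature.MathematicalPhysics.QuantumFieldTheory.Balaban1983to89.B5Composition116 (sites)
open Summit.QuantumFields.BalabanUV.T4Continuum.VariationalCovariantUpperBound (mul_conj_of_norm_one)
open Summit.QuantumFields.BalabanUV.T4Continuum.VariationalCovariantTower (Rtr)
open Summit.QuantumFields.BalabanUV.T4Continuum.VariationalTaxiCoarse (coarseT)
open Summit.QuantumFields.BalabanUV.T4Continuum.VariationalColourFederbush (phase piTv piTv_phase norm_phase)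
open Summit.QuantumFields.BalabanUV.T4Continuum.VariationalColourTower (Rtrv)
open Summit.QuantumFields.BalabanUV.T4Continuum.VariationalColourTaxiTransport (coarseTv Rlev)

variable {d : ℕ}

/-! ## §1 The `E = ℂ` dictionary: unit phases are unitary multiplication operators -/

section Phase

/-- products of phase operators are the phase operator of the product. [folklore] -/
theorem phase_mul_phase {X Y : Type*} (R : X → ℂ) (S : Y → ℂ) (x : X) (y : Y) :
    phase R x * phase S y = (R x * S y) • (1 : ℂ →L[ℂ] ℂ) := by
  simp only [phase]
  rw [smul_mul_smul_comm, mul_one]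

/-- differences of phase operators have the norm of the difference of the phases. [folklore] -/
theorem norm_phase_sub_phase {X Y : Type*} (R : X → ℂ) (S : Y → ℂ) (x : X) (y : Y) : ‖phase R x - phase S y‖ = ‖R x - S y‖ := by
  have e : phase R x - phase S y = (R x - S y) • (1 : ℂ →L[ℂ] ℂ) := by
    refine ContinuousLinearMap.ext fun v => ?_
    simp [phase, sub_mul]
  rw [e, norm_smul, norm_one, mul_one]

/-- the adjoint of a phase operator is the conjugate phase. [folklore] -/
theorem star_phase {X : Type*} (R : X → ℂ) (x : X) : star (phase R x) = (conj (R x)) • (1 : ℂ →L[ℂ] ℂ) := by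
  simp only [phase]
  rw [star_smul, star_one]
  rfl

/-- **A UNIT PHASE IS A UNITARY MULTIPLICATION OPERATOR.** [folklore] -/
theorem phase_mem_unitary {X : Type*} {R : X → ℂ} {x : X} (h : ‖R x‖ = 1) : phase R x ∈ unitary (ℂ →L[ℂ] ℂ) := by
  rw [Unitary.mem_iff, star_phase]
  simp only [phase]
  rw [smul_mul_smul_comm, smul_mul_smul_comm, mul_one, (mul_conj_of_norm_one h).1, (mul_conj_of_norm_one h).2, one_smul]
  exact ⟨rfl, rfl⟩

end Phase

/-! ## §2 The operator Wilson-line tower: unitary, plaquette class -/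

section Tower

variable (L : ℕ) [NeZero L] (M : Fin d → ℕ) [hM : ∀ μ, NeZero (M μ)] (A : (Fin d → ℝ) → Fin d → ℝ)

/-- **THE OPERATOR WILSON-LINE TOWER**: the level-`k+1` one-step bond operators (spacing `(L^k·L)⁻¹`), presented over the level-`k` torus as the
vector END's data `R′ k` — multiplication by the Wilson lines of `A`. [folklore] -/
def wlTower (k : ℕ) : Tor (fine L (fine (L ^ k) M)) → Fin d → (ℂ →L[ℂ] ℂ) := fun x => phase (wlR (L ^ k * L) A x)

/-- the plaquette-class sequence `b_k := 2·lip∕(L^{k+1})²`. [folklore] -/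
def wlB (lip : ℝ) (k : ℕ) : ℝ := 2 * lip / (((L ^ (k + 1) : ℕ)) : ℝ) ^ 2

/-- the size sequence of the regular presentation `ar_k := α₀∕L^k`. [folklore] -/
def wlAr (α₀ : ℝ) (k : ℕ) : ℝ := α₀ / (((L ^ k : ℕ)) : ℝ)

/-- the own-direction Lipschitz sequence of the regular presentation `ℓr_k := lip∕(L^k)²`. [folklore] -/
def wlLr (lip : ℝ) (k : ℕ) : ℝ := lip / (((L ^ k : ℕ)) : ℝ) ^ 2

omit [NeZero L] hM in
/-- `wlTower` unfolded at a bond. [folklore] -/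
theorem wlTower_apply (k : ℕ) (x : Tor (fine L (fine (L ^ k) M))) (μ : Fin d) :
    wlTower L M A k x μ = (wlR (L ^ k * L) A x μ) • (1 : ℂ →L[ℂ] ℂ) := rfl

omit [NeZero L] hM in
/-- the END's `hU`: **THE WILSON-LINE TOWER IS UNITARY.** [folklore] -/
theorem wlTower_mem_unitary (k : ℕ) (x : Tor (fine L (fine (L ^ k) M))) (μ : Fin d) : wlTower L M A k x μ ∈ unitary (ℂ →L[ℂ] ℂ) :=
  phase_mem_unitary (norm_wlR _ A x μ)

omit [NeZero L] hM in
/-- the moduli of the level-`k` one-step torus: `L·(L^k·M_ν) = (L^k·L)·M_ν`. [folklore] -/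
theorem fine_fine_eq (k : ℕ) (ν : Fin d) : fine L (fine (L ^ k) M) ν = L ^ k * L * M ν := by
  show L * (L ^ k * M ν) = L ^ k * L * M ν
  ring

variable {A} {lip : ℝ}

/-- the END's `hb`: **THE PLAQUETTE COMMUTATOR OF THE WILSON-LINE TOWER** — `‖R′x κ·R′(x+e_κ) ι − R′x ι·R′(x+e_ι) κ‖ ≤ 2·lip∕(L^{k+1})²`. [folklore] -/
theorem wlTower_comm_le (hA : Continuous A) (hlip : ∀ p ν (h : ℝ) μ, |A (p + h • ev ν) μ - A p μ| ≤ lip * |h|)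
    (hper : ∀ p ν, A (p + (M ν : ℝ) • ev ν) = A p) (k : ℕ) (x : Tor (fine L (fine (L ^ k) M))) (κ ι : Fin d) :
    ‖wlTower L M A k x κ * wlTower L M A k (x + unitVec (fine L (fine (L ^ k) M)) κ) ι
      - wlTower L M A k x ι * wlTower L M A k (x + unitVec (fine L (fine (L ^ k) M)) ι) κ‖ ≤ wlB L lip k := by
  have e : wlTower L M A k x κ * wlTower L M A k (x + unitVec (fine L (fine (L ^ k) M)) κ) ι
      - wlTower L M A k x ι * wlTower L M A k (x + unitVec (fine L (fine (L ^ k) M)) ι) κ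
      = (wlR (L ^ k * L) A x κ * wlR (L ^ k * L) A (x + unitVec (fine L (fine (L ^ k) M)) κ) ι
          - wlR (L ^ k * L) A x ι * wlR (L ^ k * L) A (x + unitVec (fine L (fine (L ^ k) M)) ι) κ) • (1 : ℂ →L[ℂ] ℂ) := by
    refine ContinuousLinearMap.ext fun v => ?_
    simp [wlTower, phase]
    ring
  rw [e, norm_smul, norm_one, mul_one]
  have hn : 0 < L ^ k * L := Nat.pos_of_ne_zero (NeZero.ne _)
  exact norm_wlR_comm_le (L ^ k * L) (fine_fine_eq L M k) hn hA hlip hper x κ ι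

omit [NeZero L] in
/-- `0 ≤ b_k` for `0 ≤ lip`. [folklore] -/
theorem wlB_nonneg (hlip0 : 0 ≤ lip) (k : ℕ) : 0 ≤ wlB L lip k := by
  unfold wlB; positivity

/-- the END's `hbc`, EXACTLY SCALE-INVARIANT: `(L^{k+1})²·b_k = 2·lip`. [folklore] -/
theorem wlB_class (lip : ℝ) (k : ℕ) : (((L ^ (k + 1) : ℕ)) : ℝ) ^ 2 * wlB L lip k = 2 * lip := by
  have h : (((L ^ (k + 1) : ℕ)) : ℝ) ≠ 0 := by exact_mod_cast NeZero.ne _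
  unfold wlB
  field_simp

/-- the Lipschitz constant is nonnegative (read off `hlip` at any point). [folklore] -/
theorem lip_nonneg [NeZero d] (hlip : ∀ p ν (h : ℝ) μ, |A (p + h • ev ν) μ - A p μ| ≤ lip * |h|) : 0 ≤ lip := by
  have h := hlip 0 0 1 0
  rw [abs_one, mul_one] at h
  exact (abs_nonneg _).trans h

end Tower

/-! ## §3 Exact coherence of the operator tower -/

section Coherent

variable (L : ℕ) [NeZero L] (M : Fin d → ℕ) [hM : ∀ μ, NeZero (M μ)] {A : (Fin d → ℝ) → Fin d → ℝ}

/-- the straight coarsening of a phase field is the phase of the scalar straight coarsening. [folklore] -/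
theorem coarseTv_phase (N : Fin d → ℕ) [∀ ν, NeZero (N ν)] (R : Tor (fine L N) → Fin d → ℂ) (y : Tor N) (μ : Fin d) :
    coarseTv L N (fun x => phase (R x)) y μ = (coarseT L N R y μ) • (1 : ℂ →L[ℂ] ℂ) := by
  rw [coarseTv, piTv_phase]
  rfl

/-- the END's `hcoh`: **THE WILSON-LINE TOWER IS COHERENT** — each level's straight `L`-bond coarsening IS the previous level, exactly. [folklore] -/
theorem wlTower_coherent (hA : Continuous A) (k : ℕ) :
    coarseTv L (fine (L ^ (k + 1)) M) (wlTower L M A (k + 1)) = Rtrv (L ^ k) L M (wlTower L M A k) := by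
  funext y μ
  have h1 : coarseTv L (fine (L ^ (k + 1)) M) (wlTower L M A (k + 1)) y μ = (wlR (L ^ (k + 1)) A y μ) • (1 : ℂ →L[ℂ] ℂ) := by
    show coarseTv L (fine (L ^ (k + 1)) M) (fun x => phase (wlR (L ^ (k + 1) * L) A x)) y μ = _
    rw [coarseTv_phase, coarseT_wlR (L ^ (k + 1)) L M hA]
  have h2 : Rtrv (L ^ k) L M (wlTower L M A k) y μ = (wlR (L ^ k * L) A y μ) • (1 : ℂ →L[ℂ] ℂ) := by
    have h := congrFun (congrFun (Rtr_wlR (L ^ k) L M (L ^ k * L) A) y) μ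
    rw [Rtr] at h
    rw [Rtrv, wlTower_apply]
    exact congrArg (fun c : ℂ => c • (1 : ℂ →L[ℂ] ℂ)) h
  rw [h1, h2]
  rfl

end Coherent

/-! ## §4 The regular presentation of the level bond operators -/

section Regular

variable (L : ℕ) [NeZero L] (M : Fin d → ℕ) [hM : ∀ μ, NeZero (M μ)] {A : (Fin d → ℝ) → Fin d → ℝ} {α₀ lip : ℝ}

/-- **THE LEVEL-`k` BOND OPERATORS OF THE WILSON-LINE TOWER ARE THE WILSON LINES AT SPACING `(L^k)⁻¹`.** [folklore] -/
theorem Rlev_wlTower (hA : Continuous A) : ∀ (k : ℕ) (x : Tor (fine (L ^ k) M)) (μ : Fin d),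
    Rlev L M (wlTower L M A) k x μ = (wlR (L ^ k) A x μ) • (1 : ℂ →L[ℂ] ℂ)
  | 0, x, μ => by
    show coarseTv L (fine (L ^ 0) M) (fun x => phase (wlR (L ^ 0 * L) A x)) x μ = _
    rw [coarseTv_phase, coarseT_wlR (L ^ 0) L M hA]
  | k + 1, x, μ => by
    show Rtrv (L ^ k) L M (wlTower L M A k) x μ = _
    have h := congrFun (congrFun (Rtr_wlR (L ^ k) L M (L ^ k * L) A) x) μ
    rw [Rtr] at h
    rw [Rtrv, wlTower_apply]
    exact congrArg (fun c : ℂ => c • (1 : ℂ →L[ℂ] ℂ)) h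

/-- the END's `har`: **SIZE OF THE REGULAR PRESENTATION** — `‖Rlev k x μ − 1‖ ≤ α₀∕L^k`. [folklore] -/
theorem norm_Rlev_wlTower_sub_one_le (hA : Continuous A) (hbd : ∀ p μ, |A p μ| ≤ α₀) (k : ℕ) (x : Tor (fine (L ^ k) M)) (μ : Fin d) :
    ‖Rlev L M (wlTower L M A) k x μ - 1‖ ≤ wlAr L α₀ k := by
  have e : Rlev L M (wlTower L M A) k x μ - 1 = (wlR (L ^ k) A x μ - 1) • (1 : ℂ →L[ℂ] ℂ) := by
    rw [Rlev_wlTower L M hA]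
    refine ContinuousLinearMap.ext fun v => ?_
    simp [sub_mul]
  rw [e, norm_smul, norm_one, mul_one]
  exact norm_wlR_sub_one_le (L ^ k) hbd (Nat.pos_of_ne_zero (NeZero.ne _)) x μ

omit [NeZero L] hM in
/-- `0 ≤ ar_k` for `0 ≤ α₀`. [folklore] -/
theorem wlAr_nonneg (hα0 : 0 ≤ α₀) (k : ℕ) : 0 ≤ wlAr L α₀ k := by
  unfold wlAr; positivity

omit hM in
/-- the END's `hα`, EXACTLY SCALE-INVARIANT: `L^k·ar_k = α₀`. [folklore] -/
theorem wlAr_class (α₀ : ℝ) (k : ℕ) : (((L ^ k : ℕ)) : ℝ) * wlAr L α₀ k = α₀ := by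
  have h : (((L ^ k : ℕ)) : ℝ) ≠ 0 := by exact_mod_cast NeZero.ne _
  unfold wlAr
  field_simp

/-- the END's `hℓr`: **OWN-DIRECTION LIPSCHITZ OF THE REGULAR PRESENTATION** — `‖Rlev k x μ − Rlev k (x − e_μ) μ‖ ≤ lip∕(L^k)²`. [folklore] -/
theorem norm_Rlev_wlTower_sub_back_le (hA : Continuous A) (hlip : ∀ p ν (h : ℝ) μ, |A (p + h • ev ν) μ - A p μ| ≤ lip * |h|)
    (hper : ∀ p ν, A (p + (M ν : ℝ) • ev ν) = A p) (k : ℕ) (x : Tor (fine (L ^ k) M)) (μ : Fin d) :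
    ‖Rlev L M (wlTower L M A) k x μ - Rlev L M (wlTower L M A) k (x - unitVec (fine (L ^ k) M) μ) μ‖ ≤ wlLr L lip k := by
  have e : Rlev L M (wlTower L M A) k x μ - Rlev L M (wlTower L M A) k (x - unitVec (fine (L ^ k) M) μ) μ
      = (wlR (L ^ k) A x μ - wlR (L ^ k) A (x - unitVec (fine (L ^ k) M) μ) μ) • (1 : ℂ →L[ℂ] ℂ) := by
    rw [Rlev_wlTower L M hA, Rlev_wlTower L M hA]
    refine ContinuousLinearMap.ext fun v => ?_
    simp [sub_mul]
  rw [e, norm_smul, norm_one, mul_one]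
  exact norm_wlR_sub_wlR_back_le (L ^ k) (fun ν => rfl) (Nat.pos_of_ne_zero (NeZero.ne _)) hA hlip hper x μ

omit [NeZero L] hM in
/-- the END's `hlam`, EXACTLY SCALE-INVARIANT: `(L^k)²·ℓr_k = lip`. [folklore] -/
theorem wlLr_class [NeZero L] (lip : ℝ) (k : ℕ) : (((L ^ k : ℕ)) : ℝ) ^ 2 * wlLr L lip k = lip := by
  have h : (((L ^ k : ℕ)) : ℝ) ≠ 0 := by exact_mod_cast NeZero.ne _
  unfold wlLr
  field_simp

end Regular

end Summit.QuantumFields.BalabanUV.T4Continuum.WilsonLineTower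

end
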